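import Literature.Computability.QuantumComplexity.RevGadgets
import HarnessLib

/-!
# Frame lemmas for flag-guarded classical programs

Topic `Literature/Computability/QuantumComplexity`; sequel of `RevGadgets.lean` (`ClOp`, `clEval`,
`ClOp.guard_congr`, `clEval_apply_of_forall_target_ne`). A straight-line Toffoli program that routes, copies or
erases the registers of one among several **slots** guards every operation touching slot `s` by a FLAG wire;
when the flag is off, the program neither changes the slot's wires nor lets anything else depend on them.
These are the two hypotheses (`fix`, `indep`) of label-set-relative locality (`BasisMapLocalityOn.LocalOn`)
for the compiled program, proved here at the level of `clEval`:

* `ClOp.guard_eq_false_of_control` — a false control kills the guard; `ClOp.eval_eq_self_of_guard`;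
* `clEval_congr_on` — on a set `S` containing all controls, the result on `S` depends only on the input on `S`;
* **`clEval_apply_of_flags_off`** — if every operation targeting `T` has a control in the flag set `F`, no
  operation targets `F`, and the flags are off, then the wires of `T` keep their values;
* **`clEval_congr_off_of_flags_off`** — if moreover every operation READING `T` has a control in `F` and
  `F ∩ T = ∅`, then the result off `T` does not depend on the content of `T`.

Used for the flag-controlled routing / copying / erasing stages of the universal circuit of Regev's one-copy
sampler (J. ACM 56 (2009), art. 34, Lemma 3.14): the inactive slots are idle wires for them.

Everything is proved; no definition, no named fact is introduced.

## References

* M. A. Nielsen, I. L. Chuang, *Quantum Computation and Quantum Information*, CUP 2010, §3.2.5, §4.3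
  (controlled operations) [NielsenChuang2010].
* S. Arora, B. Barak, *Computational Complexity*, CUP 2009, §10.3.7 Lemma 10.10 [AroraBarakCC2009].
* O. Regev, *On lattices, learning with errors, random linear codes, and cryptography*, J. ACM 56 (2009),
  art. 34, Lemma 3.14 (proof) [Regev2009].
-/

namespace Literature.Computability.QuantumComplexity

variable {ι : Type*}

namespace ClOp

/-- **A false control kills the guard.** [cite: NielsenChuang2010, §4.3] -/
theorem guard_eq_false_of_control (op : ClOp ι) {w : ι → Bool} {c : ι} (hc : c ∈ op.controls) (hw : w c = false) :
    op.guard w = false := by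
  cases op with
  | not i => simp [controls] at hc
  | cnot i j =>
    simp only [controls, List.mem_singleton] at hc
    subst hc
    simpa [guard] using hw
  | toffoli a b t =>
    simp only [controls, List.mem_cons, List.not_mem_nil, or_false] at hc
    rcases hc with rfl | rfl <;> simp [guard, hw]

variable [DecidableEq ι]

/-- An operation with a false guard does nothing. [folklore] -/
theorem eval_eq_self_of_guard (op : ClOp ι) {w : ι → Bool} (h : op.guard w = false) : op.eval w = w := by
  funext i
  rw [eval_apply, h, Bool.and_false, Bool.xor_false]

/-- **The result on a set containing the controls depends only on the input on that set** (one operation).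
[folklore] -/
theorem eval_congr_on (op : ClOp ι) {S : Set ι} (hc : ∀ c ∈ op.controls, c ∈ S) {w w' : ι → Bool}
    (h : ∀ i ∈ S, w i = w' i) : ∀ i ∈ S, op.eval w i = op.eval w' i := by
  intro i hi
  rw [eval_apply, eval_apply, h i hi, guard_congr op fun c hcc => h c (hc c hcc)]

end ClOp

variable [DecidableEq ι]

/-- **The result on a set containing all controls depends only on the input on that set.** [cite: AroraBarakCC2009, §10.3.7 Lemma 10.10] -/
theorem clEval_congr_on {S : Set ι} :
    ∀ (ops : List (ClOp ι)), (∀ op ∈ ops, ∀ c ∈ op.controls, c ∈ S) →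
      ∀ {w w' : ι → Bool}, (∀ i ∈ S, w i = w' i) → ∀ i ∈ S, clEval ops w i = clEval ops w' i
  | [], _, _, _, h => h
  | op :: ops, hc, _, _, h => by
    rw [clEval_cons, clEval_cons]
    exact clEval_congr_on ops (fun o ho => hc o (List.mem_cons_of_mem op ho))
      (ClOp.eval_congr_on op (hc op List.mem_cons_self) h)

/-- **Flags off ⇒ the guarded wires keep their values**: if every operation targeting a wire of `T` has a
control in `F`, no operation targets `F`, and all flags of `F` are off, the program does not change `T`.
[cite: NielsenChuang2010, §4.3] [cite: Regev2009, Lemma 3.14 (proof)] -/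
theorem clEval_apply_of_flags_off {T F : Set ι} :
    ∀ (ops : List (ClOp ι)), (∀ op ∈ ops, op.target ∈ T → ∃ c ∈ op.controls, c ∈ F) →
      (∀ op ∈ ops, op.target ∉ F) → ∀ {w : ι → Bool}, (∀ c ∈ F, w c = false) →
        ∀ i ∈ T, clEval ops w i = w i
  | [], _, _, _, _, _, _ => rfl
  | op :: ops, hT, hF, w, hw, i, hi => by
    rw [clEval_cons]
    have hw' : ∀ c ∈ F, op.eval w c = w c := fun c hc =>
      ClOp.eval_apply_of_ne op w fun h => hF op List.mem_cons_self (h ▸ hc)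
    rw [clEval_apply_of_flags_off ops (fun o ho => hT o (List.mem_cons_of_mem op ho))
      (fun o ho => hF o (List.mem_cons_of_mem op ho)) (fun c hc => (hw' c hc).trans (hw c hc)) i hi]
    by_cases ht : op.target ∈ T
    · obtain ⟨c, hc, hcF⟩ := hT op List.mem_cons_self ht
      rw [ClOp.eval_eq_self_of_guard op (ClOp.guard_eq_false_of_control op hc (hw c hcF))]
    · exact ClOp.eval_apply_of_ne op w fun h => ht (h ▸ hi)

/-- **Flags off ⇒ nothing else depends on the guarded wires**: if every operation reading or targeting a
wire of `T` has a control in `F`, no operation targets `F`, `F` is disjoint from `T`, and the flags are off,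
then two inputs agreeing off `T` give results agreeing off `T`. [cite: NielsenChuang2010, §4.3] [cite: Regev2009, Lemma 3.14 (proof)] -/
theorem clEval_congr_off_of_flags_off {T F : Set ι} (hFT : ∀ c ∈ F, c ∉ T) :
    ∀ (ops : List (ClOp ι)), (∀ op ∈ ops, (∃ c ∈ op.controls, c ∈ T) → ∃ c ∈ op.controls, c ∈ F) →
      (∀ op ∈ ops, op.target ∉ F) → ∀ {w w' : ι → Bool}, (∀ c ∈ F, w c = false) →
        (∀ i, i ∉ T → w i = w' i) → ∀ i, i ∉ T → clEval ops w i = clEval ops w' i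
  | [], _, _, _, _, _, h => h
  | op :: ops, hR, hF, w, w', hw, h => by
    rw [clEval_cons, clEval_cons]
    have hw1 : ∀ c ∈ F, op.eval w c = false := fun c hc => by
      rw [ClOp.eval_apply_of_ne op w fun h' => hF op List.mem_cons_self (h' ▸ hc), hw c hc]
    refine clEval_congr_off_of_flags_off hFT ops (fun o ho => hR o (List.mem_cons_of_mem op ho))
      (fun o ho => hF o (List.mem_cons_of_mem op ho)) hw1 fun i hi => ?_
    by_cases hread : ∃ c ∈ op.controls, c ∈ T
    · -- a guarded operation: off in both runs
      obtain ⟨c, hc, hcF⟩ := hR op List.mem_cons_self hread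
      rw [ClOp.eval_eq_self_of_guard op (ClOp.guard_eq_false_of_control op hc (hw c hcF)),
        ClOp.eval_eq_self_of_guard op (ClOp.guard_eq_false_of_control op hc ((h c (hFT c hcF)).symm.trans (hw c hcF) ▸ rfl)),
        h i hi]
    · -- all controls off `T`: the guards agree
      push Not at hread
      rw [ClOp.eval_apply, ClOp.eval_apply, h i hi, ClOp.guard_congr op fun c hc => h c (hread c hc)]

end Literature.Computability.QuantumComplexity
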